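import Summits.Ventures.Crystal3D.Theorems.StickyWulffConstantTextureLiminfTentFrameWulff
import HarnessLib

/-!
# TB-D: the grain Wulff body's support function is at most `√5` — the constant `3` of `gapCost` is safe
# (lane T, crux `TextureLiminfV5`, stmt-Ventures-23912; design memo TB-D-0 §4 (D), §5 S-bricks)

HONEST FRAMING. Venture `Summits/Ventures/Crystal3D` (cell `crystal3d-full`), route `route-Ventures-StickyWulffConstant`, helper `--supports` the
law-v5 crux `TextureLiminfV5` (stmt-Ventures-23912).  Packaging of tree facts (census-free, standard axioms): `phiB = phiFcc ∘ toRef⁻¹`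
(…TentFrameWulff) and Literature's `phiFcc ν ≤ √5·‖ν‖` (…FccSurfaceTension).  Nothing about any texture; F-C1 not moved.

WHY.  The mesh books every DESIGNATED facet and every prism lateral at `3·facetArea` (`Mesh₃.gapCost`); the texture assembly must show that a facet of a
slab grain with Wulff body `wulffOf A` costs at most `h_{wulffOf A}(ν)·area ≤ 3·area` for a unit normal.  Here: `supportFn (wulffOf A) ν ≤ phiB (A⁻¹ν)
≤ √5·‖ν‖ < 3‖ν‖`.
* `phiB_nonneg`, `phiB_le_sqrt_five_mul_norm`;
* `zero_mem_wulffOf`, `supportFn_wulffOf_le_phiB`, **`supportFn_wulffOf_le`** (`≤ √5‖ν‖`), `supportFn_wulffOf_le_three` (unit `ν`).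
-/

noncomputable section

namespace Summit.Ventures.Crystal3D.Cruxes.TextureLiminf.TexShadow

open Summit.Ventures.Crystal3D
open scoped InnerProductSpace
open Literature.MathematicalPhysics.StatisticalMechanics (phiFcc phiFcc_nonneg phiFcc_le_sqrt_five_mul_norm)
open Summit.Ventures.Crystal3D.TentCertificate (toRef phiB_eq_phiFcc)

/-- `phiB ≥ 0`. -/
theorem phiB_nonneg (ν : E3) : 0 ≤ phiB ν := by
  rw [phiB_eq_phiFcc]; exact phiFcc_nonneg _

/-- **`phiB ν ≤ √5·‖ν‖`** (the fcc broken-bond tension is at most `√5` on unit normals). -/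
theorem phiB_le_sqrt_five_mul_norm (ν : E3) : phiB ν ≤ Real.sqrt 5 * ‖ν‖ := by
  rw [phiB_eq_phiFcc, ← LinearIsometryEquiv.norm_map toRef.symm ν]
  exact phiFcc_le_sqrt_five_mul_norm _

/-- The Wulff body of a grain contains the origin. -/
theorem zero_mem_wulffOf (A : E3 ≃ₗᵢ[ℝ] E3) : (0 : E3) ∈ wulffOf A := by
  intro ν
  rw [inner_zero_left]
  exact phiB_nonneg _

/-- `h_{wulffOf A}(ν) ≤ phiB (A⁻¹ ν)` (the Wulff body is cut out by exactly these half-spaces). -/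
theorem supportFn_wulffOf_le_phiB (A : E3 ≃ₗᵢ[ℝ] E3) (ν : E3) : supportFn (wulffOf A) ν ≤ phiB (A.symm ν) := by
  unfold supportFn
  refine csSup_le ⟨_, ⟨0, zero_mem_wulffOf A, rfl⟩⟩ ?_
  rintro _ ⟨y, hy, rfl⟩
  exact hy ν

/-- **`h_{wulffOf A}(ν) ≤ √5·‖ν‖`.** -/
theorem supportFn_wulffOf_le (A : E3 ≃ₗᵢ[ℝ] E3) (ν : E3) : supportFn (wulffOf A) ν ≤ Real.sqrt 5 * ‖ν‖ := by
  refine (supportFn_wulffOf_le_phiB A ν).trans ?_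
  have h := phiB_le_sqrt_five_mul_norm (A.symm ν)
  rwa [LinearIsometryEquiv.norm_map] at h

/-- **`h_{wulffOf A}(ν) ≤ 3`** for a unit normal — the support bound used by `Mesh₃.gapCost`. -/
theorem supportFn_wulffOf_le_three (A : E3 ≃ₗᵢ[ℝ] E3) {ν : E3} (hν : ‖ν‖ = 1) : supportFn (wulffOf A) ν ≤ 3 := by
  refine (supportFn_wulffOf_le A ν).trans ?_
  rw [hν, mul_one]
  have h5 : Real.sqrt 5 ≤ Real.sqrt 9 := Real.sqrt_le_sqrt (by norm_num)
  have h9 : Real.sqrt 9 = 3 := by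
    rw [show (9 : ℝ) = 3 ^ 2 by norm_num, Real.sqrt_sq (by norm_num)]
  linarith

end Summit.Ventures.Crystal3D.Cruxes.TextureLiminf.TexShadow

end
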